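import Literature.MathematicalPhysics.QuantumFieldTheory.Balaban1983to89.B9Letters313AtOneQ

/-!
# `Balaban1983to89.B9LettersHZAtOne` — [B9] (3.126) ∕ (3.133) at the TRIVIAL BACKGROUND in the R1-cls CLASSES: the `G₀Q*`- and `∇_UG₀Q*`-letters
# OUT OF A BLOCK-COUNT-WEIGHTED COARSE CLASS (dag-n06-l's `LettersHZ.gQs2 ∕ dgQs` with `bZ` = the `n⁻¹`-weighted sup class, node00-def-Y (W2))
# HOLD AT `U = 1` at the pinned letters, uniformly on the k-level census — the flat `Q*` kernel carries the plateau `q_y ≤ L^{−j(y)(d+1)} = n_y⁻¹`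

T. Bałaban, *Propagators for lattice gauge theories in a background field*, Commun. Math. Phys. **99** (1985) 389–434
[`Balaban1985BackgroundPropagators`, "B9"]; [4] = T. Bałaban, *Propagators and renormalization transformations for lattice gauge
theories. II*, Commun. Math. Phys. **96** (1984) 223–250 [`Balaban1984PropagatorsII`]; [5] = part I, Commun. Math. Phys. **95** (1984) 17–40
[`Balaban1984PropagatorsI`].

statement-level skeleton of published theorems with citation tags; proofs where landed; nothing here is a claim about the Yang–Mills
mass gap

THE PRINTED LOCI (verbatim).  [B9] p. 420: *"They imply the formula HB = GQ\*(QGQ\*)⁻¹B. (3.126)"*; p. 422 (3.132)–(3.133), derived *"together with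
Theorem 3.3 for G"*; p. 391 (the η- ∕ (Lʲη)-weighted scalar products defining the adjoint `Q*`); p. 407, before Cor. 3.5: *"There we have proved these
theorems for operators with the external gauge field configuration U = 1."*  [5] (1.18) p. 20 (the averaging weights: each start of the straight
contour of a level-`j` bond carries the weight `L^{−j(d+1)}·L^{−j}` per step, `Lʲ` steps); [4] Prop. 2.6 (2.136) p. 247, Lemma 2.1 (2.61) p. 234.

THE POINT (R1-cls, bus 2026-08-27: dag-n06-h LOCATED «C-LETTER-FLAT-AT-ONE» `B9LettersHCOneObstruction`, node00-def-Y (W2), dag-n06-l `B9Thm312WholeHZ`).  The flat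
reading `QsY` of `Q*` is print's `Q*` DIVIDED by the block count `n_y = L^{j(y)(d+1)}`; with the flat middle class `𝔠_Z⁽⁰⁾` the C-letters of `LettersH`
are unsatisfiable, so dag-n06-l re-types the middle class of `H = (G₀Q*) ∘ C` as a PARAMETER `bZ`, pinned by the knit to the `n⁻¹`-weighted sup class
`weightNorm (ofBlocks blkZ) (fun y => (n y)⁻¹)`.  THIS FILE supplies the `U = 1` inhabitants of the two `G₀`-side fields at such a class: for ANY weight
`W` dominating the plateau of the flat weights, `W(a′) ≥ (L^{d+1})^{−j(a′)}` (equality for the block count), the composite `G₀(1)Q*(1)` maps the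
`W`-weighted coarse sup class into `𝔠⁽²⁾`, and `∇_U G₀(1)Q*(1)` into `𝔠_Y⁽¹⁾`, with MEMBER-UNIFORM constants — because `|Q*♭ω| ≤ L^{−j(a′)(d+1)}|ω(a′)|`
(r03's `qwt_le`) and (2.136)₀,₁ + (2.61) bound `G ∕ ∇G` on such a source exactly as in dag-n06-h's `B9LettersHAtOneG0` (whose §5 engine
`abs_apply_le_of_near` is reused verbatim; only the bound fed to it changes from `|ω|` to `n⁻¹|ω|`).
* §1 `abs_qsK_mulVec_le_plateau` — the flat `Q*` kernel on a one-block `ω`: `|Q*♭ω| ≤ (L^{d+1})^{−j(a′)}·B`; ★ `hasMajorantHom_comp_qsK_bI_plateau` — dag-n06-h's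
  re-blocking lemma with the plateau factor in the kernel;
* §2 at the pins: ★★ `hasMaj_G0_Qstar_one_Z` (`LettersHZ.gQs2` ∕ `Letters313Z.gQs2` at `U ↦ 1`), ★★ `hasMaj_D_G0_Qstar_one_Z` (`LettersHZ.dgQs`), ★★
  `hasMaj_G0_Qstar_one_Z_split` (`Letters313Z.gQs1`: source weight `Lʲ′η·W`, one (2.60) transfer via `B9Letters313AtOneQ.len_pow_le_of_transfer`), every
  weight `W ≥` plateau; `plateau_eq_len_div_eta_pow` — the block count IS `((Lʲη)∕η)^{d+1}` in `geo9K` (def-Y's `n y = (len y ∕ η)^{d+1}`: equality);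
* §3 ★★★ `lettersHZ_G0_one_kIdx` — uniformly on the census (one threshold, one constant, one rate; N03's Prop. 2.6 constants and p21's (2.61) row sum).

HONEST SCOPE.  A READING file: analytic input N03's Prop. 2.6 (via dag-n06-h `hasMajorant_Gop_kIdx`) and p21's Lemma 2.1 (`consts_260_261`), tree
theorems cited by name; the re-classed C-letters (`LettersHZ.c2 ∕ c12`, [4] Prop. 2.7 ∕ (2.142)) are NOT treated here (dag-n06-h ∕ dag-n06-i lineage);
nothing of [B9] at curved `U` is asserted; no displayed `∀U`-binder is witnessed.  COUNT-NEUTRAL; N06 NOT discharged; one finite lattice at a time;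
nothing continuum, nothing about the mass gap.  Cell `pub-ymgap` (HUMAN RULING D-0062 ∕ D-0149), Track A node N06 [B9], width seat
`pub-ymgap-dag-n06-w3` (g0), 2026-08-27.
-/

noncomputable section

namespace Literature.MathematicalPhysics.QuantumFieldTheory.Balaban1983to89.B9LettersHZAtOne

open B6MultiLevelTorusOperator (TDomains)
open B6Geom246MultiLevelTorus (geomT)
open B6GlobalChartV1 (PV blkV1)
open B6KLevelCensusIndexV1 (KIdx kGeo kGeoG)
open B6GradLegKLevelV1 (DV)
open B6Prop26Census2136KLevelV1 (Gop)
open B6RandomWalk (HasMajorant BlockSupp)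
open B6RandomWalkHom (HasMajorantHom)
open B6Ineq2142KLevelV1 (lvl β qwt qwt_le qwt_nonneg)
open B6Ineq288MultiLevelTorus (dist_symm_geoBT)
open B9Thm314GpFlatMultiLevelTorus (consts_260_261)
open B6Lemma21Repaired (Ineq261With)
open B9GeoNormsKLevelV1 (geo9K)
open B9GeoLemma21KLevelV1 (one_le_Mh)
open B9Ineq349SiteComposite (distB distB_nonneg)
open B9Ineq349SiteFromBlocks (distB_triangle)
open B9Thm39ReadingCoords (cR39 cR39_nonneg)
open B9Thm34Ext (toB6)
open B9SectDSup (weightNorm)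
open B11SectG (HasMaj BlockNorm)
open B9Thm312Whole (cNorm GeoOK Ops wt wt_nonneg)
open B9CoReadingCoords B9CoReadingCoordsH B9Prop26AtPinsOne B9LettersHAtOneG0
open B9Letters313AtOneQ (len_pow_le_of_transfer transfer_threshold)
open B9GeoLemma21KLevelV1 (geo9K_dist_comm)
open Node00 Node00.OpsYSectDCoords
open scoped Matrix

variable {d ℓ : ℕ} {hd : 1 ≤ d + 1} {hL : Odd (ℓ + 1) ∧ 1 < ℓ + 1} {b₀ b₁ : ℝ}

/-! ## §1 The flat `Q*` kernel on a one-block coarse function is below the plateau; dag-n06-h's re-blocking with the plateau in the kernel -/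

section Plateau

variable (i : KIdx d ℓ hd hL b₀ b₁) {bI : FBondY i → IBondY i}

/-- the plateau `(L^{d+1})^{−j(a)} = n_a⁻¹` of the flat averaging weights of a level-`j(a)` coarse bond is positive. [cite: Balaban1984PropagatorsI, (1.18) p.20, bookkeeping] -/
theorem plateau_pos (a : IBondY i) : (0 : ℝ) < ((((ℓ + 1 : ℕ) : ℝ) ^ (d + 1)) ^ lvl i.hN i.D i.hk a)⁻¹ := by positivity

/-- **THE FLAT `Q*` KERNEL ON A ONE-BLOCK COARSE FUNCTION IS BELOW THE PLATEAU**: for `ω` supported at the coarse bond `a′` with `|ω(a′)| ≤ B`,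
`|(Q*♭ω)(z)| ≤ (L^{d+1})^{−j(a′)}·B` at every fine bond `z` (`Q*♭ω = ω(a′)·q_{a′}(·)` and r03's `qwt_le`).
[cite: Balaban1984PropagatorsI, (1.18) p.20; Balaban1984PropagatorsII, (2.18)–(2.20) p.226] -/
theorem abs_qsK_mulVec_le_plateau {a' : IBondY i} {ω : IBondY i → ℝ} {B : ℝ} (hoff : ∀ y, y ≠ a' → ω y = 0) (hB : |ω a'| ≤ B)
    (z : FBondY i) : |(qsK i *ᵥ ω) z| ≤ ((((ℓ + 1 : ℕ) : ℝ) ^ (d + 1)) ^ lvl i.hN i.D i.hk a')⁻¹ * B := by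
  have hv : (qsK i *ᵥ ω) z = qwt i.hN i.D i.hk a' z * ω a' := by
    rw [qsK_mulVec_apply, Finset.sum_eq_single a']
    · intro y _ hy; rw [hoff y hy, mul_zero]
    · intro h; exact absurd (Finset.mem_univ _) h
  rw [hv, abs_mul, abs_of_nonneg (qwt_nonneg _ _ _ _ _)]
  exact mul_le_mul (qwt_le i.hN i.D i.hk a' z) hB (abs_nonneg _) (plateau_pos i a').le

/-- ★ **RE-BLOCKING THROUGH `Q*♭` WITH THE PLATEAU** (dag-n06-h's `hasMajorantHom_comp_qsK_bI`, sharpened by the factor `n_{a′}⁻¹`): a real operator `T` on the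
fine bonds with the torus block majorant `C·ηᵐL^{mj(y)}·e^{−δd_T}` gives, after the flat `Q*` kernel, the two-space majorant
`C·c·e^{¾δ(ℓ+4)}·(Lʲη)(a)ᵐ·(L^{d+1})^{−j(a′)}·e^{−¾δ·d(a,a′)}` in `geo9K` (source block = the coarse bond, target block = a level- and 1-faithful `bI`).
[cite: Balaban1984PropagatorsII, (2.51)–(2.52) p.232, Lemma 2.1 (2.61) p.234, (2.45)–(2.46) p.231; Balaban1984PropagatorsI, (1.18) p.20; Balaban1985BackgroundPropagators, p.398 (remark after (3.47))] -/
theorem hasMajorantHom_comp_qsK_bI_plateau (hlev : ∀ f : FBondY i, lvl i.hN i.D i.hk (bI f) = (blkV1 i.hN i.D f).1.1)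
    (hβ1 : ∀ f : FBondY i, (geomT i.D).dist (β i.hN i.D i.hk (bI f)) (blkV1 i.hN i.D f) ≤ 1)
    {T : Module.End ℝ (FBondY i → ℝ)} {C δ : ℝ} (hC : 0 ≤ C) (hδ : 0 ≤ δ) (m : ℕ)
    (hT : HasMajorant (g := geomT i.D) (blkV1 i.hN i.D) T
      (fun y y' => C * |i.cf|⁻¹ ^ m * ((ℓ : ℝ) + 1) ^ (m * y.1.1) * Real.exp (-(δ * (geomT i.D).dist y y'))))
    {c : ℝ} (h261 : Ineq261With c (geomT i.D) δ (1 / 4)) (R₀ : ℝ) (H₀ : Prop) [Fintype (geo9K i).Site] :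
    HasMajorantHom (g := toB6 (geo9K i) R₀ H₀) (fun a : IBondY i => a) bI (T ∘ₗ Matrix.toLin' (qsK i))
      (fun a a' => C * c * Real.exp (3 / 4 * δ * ((ℓ : ℝ) + 4)) * (geo9K i).len a ^ m * ((((ℓ + 1 : ℕ) : ℝ) ^ (d + 1)) ^ lvl i.hN i.D i.hk a')⁻¹ *
        Real.exp (-(3 / 4 * δ * (geo9K i).dist a a'))) := by
  intro a' ω Bω hω f
  change IBondY i at a'
  have hP0 : 0 ≤ ((((ℓ + 1 : ℕ) : ℝ) ^ (d + 1)) ^ lvl i.hN i.D i.hk a')⁻¹ * Bω := mul_nonneg (plateau_pos i a').le hω.nonneg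
  have hvB : ∀ z, |(Matrix.toLin' (qsK i) ω) z| ≤ ((((ℓ + 1 : ℕ) : ℝ) ^ (d + 1)) ^ lvl i.hN i.D i.hk a')⁻¹ * Bω := fun z => by
    rw [Matrix.toLin'_apply]
    exact abs_qsK_mulVec_le_plateau i (fun y hy => hω.off y hy) (hω.bound a' rfl) z
  have hvS : ∀ z, (Matrix.toLin' (qsK i) ω) z ≠ 0 → distB i (β i.hN i.D i.hk a') (blkV1 i.hN i.D z) ≤ (ℓ : ℝ) + 3 := fun z hz => by
    have hv : (qsK i *ᵥ ω) z = qwt i.hN i.D i.hk a' z * ω a' := by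
      rw [qsK_mulVec_apply, Finset.sum_eq_single a']
      · intro y _ hy; rw [hω.off y hy, mul_zero]
      · intro h; exact absurd (Finset.mem_univ _) h
    rw [Matrix.toLin'_apply, hv] at hz
    exact dist_blkV1_le_of_qwt_ne_zero i (left_ne_zero_of_mul hz)
  have hmain := abs_apply_le_of_near i hC hδ m hT h261 (β i.hN i.D i.hk a') hP0 _ hvB hvS f
  rw [LinearMap.comp_apply]
  refine hmain.trans ?_
  set bf := blkV1 i.hN i.D f with hbf
  have htri2 : (geo9K i).dist (bI f) a' ≤ 1 + distB i bf (β i.hN i.D i.hk a') := by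
    change distB i (β i.hN i.D i.hk (bI f)) (β i.hN i.D i.hk a') ≤ 1 + distB i bf (β i.hN i.D i.hk a')
    have h1 : distB i (β i.hN i.D i.hk (bI f)) bf ≤ 1 := hβ1 f
    linarith [distB_triangle i (β i.hN i.D i.hk (bI f)) bf (β i.hN i.D i.hk a')]
  have hexp2 : Real.exp (-(3 / 4 * δ * distB i bf (β i.hN i.D i.hk a'))) ≤
      Real.exp (3 / 4 * δ) * Real.exp (-(3 / 4 * δ * (geo9K i).dist (bI f) a')) := by
    rw [← Real.exp_add]
    refine Real.exp_le_exp.2 ?_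
    have := mul_le_mul_of_nonneg_left htri2 (show (0 : ℝ) ≤ 3 / 4 * δ by positivity)
    linarith
  have hlen : |i.cf|⁻¹ ^ m * ((ℓ : ℝ) + 1) ^ (m * bf.1.1) = (geo9K i).len (bI f) ^ m := by
    rw [B9GeoNormsKLevelV1.geo9K_len_kGeo, B6KLevelCensusIndexV1.len_eq, hlev f, ← hbf, div_eq_mul_inv, mul_pow, ← pow_mul, mul_comm]
    push_cast
    ring
  have hc0 : 0 ≤ c := le_trans (Finset.sum_nonneg fun y _ => (Real.exp_pos _).le) (h261 bf)
  have h0 : 0 ≤ C * |i.cf|⁻¹ ^ m * ((ℓ : ℝ) + 1) ^ (m * bf.1.1) * (((((ℓ + 1 : ℕ) : ℝ) ^ (d + 1)) ^ lvl i.hN i.D i.hk a')⁻¹ * Bω) * c * Real.exp (3 / 4 * δ * ((ℓ : ℝ) + 3)) := by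
    positivity
  calc C * |i.cf|⁻¹ ^ m * ((ℓ : ℝ) + 1) ^ (m * bf.1.1) * (((((ℓ + 1 : ℕ) : ℝ) ^ (d + 1)) ^ lvl i.hN i.D i.hk a')⁻¹ * Bω) * c * Real.exp (3 / 4 * δ * ((ℓ : ℝ) + 3)) *
        Real.exp (-(3 / 4 * δ * distB i bf (β i.hN i.D i.hk a')))
      ≤ C * |i.cf|⁻¹ ^ m * ((ℓ : ℝ) + 1) ^ (m * bf.1.1) * (((((ℓ + 1 : ℕ) : ℝ) ^ (d + 1)) ^ lvl i.hN i.D i.hk a')⁻¹ * Bω) * c * Real.exp (3 / 4 * δ * ((ℓ : ℝ) + 3)) *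
          (Real.exp (3 / 4 * δ) * Real.exp (-(3 / 4 * δ * (geo9K i).dist (bI f) a'))) := mul_le_mul_of_nonneg_left hexp2 h0
    _ = C * c * (Real.exp (3 / 4 * δ * ((ℓ : ℝ) + 3)) * Real.exp (3 / 4 * δ)) * (|i.cf|⁻¹ ^ m * ((ℓ : ℝ) + 1) ^ (m * bf.1.1)) *
          ((((ℓ + 1 : ℕ) : ℝ) ^ (d + 1)) ^ lvl i.hN i.D i.hk a')⁻¹ * Real.exp (-(3 / 4 * δ * (geo9K i).dist (bI f) a')) * Bω := by ring
    _ = C * c * Real.exp (3 / 4 * δ * ((ℓ : ℝ) + 4)) * (geo9K i).len (bI f) ^ m * ((((ℓ + 1 : ℕ) : ℝ) ^ (d + 1)) ^ lvl i.hN i.D i.hk a')⁻¹ *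
          Real.exp (-(3 / 4 * δ * (geo9K i).dist (bI f) a')) * Bω := by
        rw [hlen, ← Real.exp_add]; ring_nf

/-- **THE BLOCK COUNT IS `((Lʲη)∕η)^{d+1}` IN `geo9K`**: `plateau a = (((len a) ∕ η)^{d+1})⁻¹` — node00-def-Y's `n y = (len y ∕ η)^{d+1}` (W2) qualifies for §2 with
equality. [cite: Balaban1984PropagatorsII, (2.1) p.224; Balaban1984PropagatorsI, (1.18) p.20] -/
theorem plateau_eq_len_div_eta_pow (a : IBondY i) :
    ((((ℓ + 1 : ℕ) : ℝ) ^ (d + 1)) ^ lvl i.hN i.D i.hk a)⁻¹ = (((geo9K i).len a / (geo9K i).eta) ^ (d + 1))⁻¹ := by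
  have hη : (geo9K i).eta = |i.cf|⁻¹ := rfl
  have hcf : (0 : ℝ) < |i.cf| := abs_pos.2 i.hcf
  rw [B9GeoNormsKLevelV1.geo9K_len_kGeo, B6KLevelCensusIndexV1.len_eq, hη, div_div, mul_inv_cancel₀ hcf.ne', div_one]
  ring

end Plateau

/-! ## §2 AT THE PINS: `G₀(1)Q*(1)` and `∇_UG₀(1)Q*(1)` out of a `W`-weighted coarse sup class, `W ≥` plateau (dag-n06-l's `LettersHZ.gQs2 ∕ dgQs` at `U ↦ 1`) -/

section Letters

variable {𝔸 : Type} [NormedRing 𝔸] [NormedAlgebra ℂ 𝔸] [CompleteSpace 𝔸] [FiniteDimensional ℝ 𝔸]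
variable {κ : Type} [Fintype κ]
variable (i : KIdx d ℓ hd hL b₀ b₁) (b : Module.Basis κ ℝ 𝔸) (B : B9.Backgrounds) (cfg : B.Cfg → CfgY 𝔸 i)
  (O : BondOpY 𝔸 i) (parB : BondParY 𝔸 i)
variable {Y W : Type}

/-- ★★ **`LettersHZ.gQs2` AT `U = 1`** — `G₀(1)Q*(1)` from the `W`-weighted coarse sup class `weightNorm (ofBlocks blkZ) W` into `𝔠⁽²⁾` with the majorant `B₃·e^{−δ₃′d}`,
for every weight `W` with `W(a′) ≥ (L^{d+1})^{−j(a′)}` (the block count: equality), at ANY letter record pinned as in dag-n06-h's `hasMaj_G0_Qstar_one`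
(`hG0co12 ∕ hQsco12`, `hblk12 ∕ hblkZ12`, `O(1)(J ⊗ E) = (GJ) ⊗ E`, transporters trivial at `1`, `bI` level- and 1-faithful): from the (2.136)₀ torus majorant
of `G = Δ_a⁻¹`, (2.61), and the plateau of the flat weights.  Constants: `B₃ = C·c·e^{¾δ(ℓ+4)}`, `δ₃′ = ¾δ` — MEMBER-UNIFORM.
[cite: Balaban1985BackgroundPropagators, (3.126) p.420, (3.132)–(3.133) p.422, Thm 3.3 p.399, p.391, Cor. 3.5 p.407; Balaban1984PropagatorsII, Prop. 2.6 (2.136) p.247, Lemma 2.1 (2.61) p.234; Balaban1984PropagatorsI, (1.18) p.20] -/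
theorem hasMaj_G0_Qstar_one_Z (hG : GeoOK (geo9K i)) [Fintype (geo9K i).Site] [Fintype Y] [Fintype W]
    (hc : cR39 b ≠ 0) (hparB : ∀ s s', parB (fun _ _ => 1) s s' = 1)
    (hO : ∀ (J : FBondY i → ℝ) (E : 𝔸), O (fun _ _ => 1) (liftY J E) = liftY (Gop i J) E) {U₁ : B.Cfg} (hU₁ : cfg U₁ = fun _ _ => 1)
    {bI : FBondY i → IBondY i} (hlev : ∀ f : FBondY i, lvl i.hN i.D i.hk (bI f) = (blkV1 i.hN i.D f).1.1)
    (hβ1 : ∀ f : FBondY i, (geomT i.D).dist (β i.hN i.D i.hk (bI f)) (blkV1 i.hN i.D f) ≤ 1)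
    (𝔬 : Ops (geo9K i) B (XBK κ i) Y (XHK κ i) W) (hblk : 𝔬.blk = blkBK i bI) (hblkZ : 𝔬.blkZ = blkHK i)
    (hG0 : 𝔬.G0 U₁ = GcoK i b B cfg O U₁) (hQs : 𝔬.Qstar U₁ = QscoKH i b B cfg parB U₁)
    {Wt : (geo9K i).Site → ℝ} (hW0 : ∀ a, 0 ≤ Wt a) (hW : ∀ a : IBondY i, ((((ℓ + 1 : ℕ) : ℝ) ^ (d + 1)) ^ lvl i.hN i.D i.hk a)⁻¹ ≤ Wt a)
    {C δ c : ℝ} (hC : 0 ≤ C) (hδ : 0 ≤ δ) (hc0 : 0 ≤ c)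
    (hT : HasMajorant (g := geomT i.D) (blkV1 i.hN i.D) (Gop i)
      (fun y y' => C * |i.cf|⁻¹ ^ 2 * ((ℓ : ℝ) + 1) ^ (2 * y.1.1) * Real.exp (-(δ * (geomT i.D).dist y y'))))
    (h261 : Ineq261With c (geomT i.D) δ (1 / 4)) {R₀ : ℝ} {H₀ : Prop} :
    HasMaj (weightNorm (BlockNorm.ofBlocks (toB6 (geo9K i) R₀ H₀) 𝔬.blkZ) Wt hW0) (cNorm R₀ H₀ 𝔬.blk hG.lenle 2) (𝔬.G0 U₁ ∘ₗ 𝔬.Qstar U₁)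
      (fun a a' => C * c * Real.exp (3 / 4 * δ * ((ℓ : ℝ) + 4)) * Real.exp (-(3 / 4 * δ * (geo9K i).dist a a'))) := by
  rw [hblk, hblkZ, hG0, hQs, GcoK_comp_QscoKH_one i b B cfg O parB hc hU₁]
  have hK := hasMajorantHom_coordOpKH_of_liftY b (G := toB6 (geo9K i) R₀ H₀) (blk' := fun a : IBondY i => a) (blk := bI)
    (T := fun _ : Fin (d + 1) => Gop i ∘ₗ Matrix.toLin' (qsK i)) (fun _ ω E => O_QsY_one_liftY i O parB hparB hO ω E)
    fun _ => hasMajorantHom_comp_qsK_bI_plateau i hlev hβ1 hC hδ 2 hT h261 R₀ H₀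
  have hK0 : ∀ a a' : (geo9K i).Site, 0 ≤ C * c * Real.exp (3 / 4 * δ * ((ℓ : ℝ) + 4)) * (geo9K i).len a ^ 2 * ((((ℓ + 1 : ℕ) : ℝ) ^ (d + 1)) ^ lvl i.hN i.D i.hk a')⁻¹ *
      Real.exp (-(3 / 4 * δ * (geo9K i).dist a a')) := fun a a' => by
    have := (hG.lenpos a).le; have := (plateau_pos i a').le; positivity
  have h0 := B9Thm37AllNorms.hasMaj_of_hasMajorantHom (G := toB6 (geo9K i) R₀ H₀) (blkHK i) (blkBK i bI) hK0 hK
  refine B9SectDSup.HasMaj.weight hW0 (wt_nonneg hG.lenle 2) h0 fun y y' => ?_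
  have hly : (geo9K i).len y ^ 2 ≠ 0 := pow_ne_zero 2 (hG.lenpos y).ne'
  have hKc : 0 ≤ C * c * Real.exp (3 / 4 * δ * ((ℓ : ℝ) + 4)) * Real.exp (-(3 / 4 * δ * (geo9K i).dist y y')) := by positivity
  calc wt (geo9K i) 2 y * (C * c * Real.exp (3 / 4 * δ * ((ℓ : ℝ) + 4)) * (geo9K i).len y ^ 2 * ((((ℓ + 1 : ℕ) : ℝ) ^ (d + 1)) ^ lvl i.hN i.D i.hk y')⁻¹ *
        Real.exp (-(3 / 4 * δ * (geo9K i).dist y y')))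
      = C * c * Real.exp (3 / 4 * δ * ((ℓ : ℝ) + 4)) * Real.exp (-(3 / 4 * δ * (geo9K i).dist y y')) *
          (((geo9K i).len y ^ 2)⁻¹ * (geo9K i).len y ^ 2) * ((((ℓ + 1 : ℕ) : ℝ) ^ (d + 1)) ^ lvl i.hN i.D i.hk y')⁻¹ := by rw [wt]; ring
    _ = C * c * Real.exp (3 / 4 * δ * ((ℓ : ℝ) + 4)) * Real.exp (-(3 / 4 * δ * (geo9K i).dist y y')) * ((((ℓ + 1 : ℕ) : ℝ) ^ (d + 1)) ^ lvl i.hN i.D i.hk y')⁻¹ := by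
        rw [inv_mul_cancel₀ hly, mul_one]
    _ ≤ _ := mul_le_mul_of_nonneg_left (hW y') hKc

/-- ★★ **`LettersHZ.dgQs` AT `U = 1`** — `∇_U G₀(1)Q*(1)` from the `W`-weighted coarse sup class into `𝔠_Y⁽¹⁾` (`W ≥` plateau), at a letter record pinned as above plus
`D` pinned to `DcoK` (`hDco12`, `hblkY12`): from the (2.136)₁ torus majorant of `∇G` and (2.61).
[cite: Balaban1985BackgroundPropagators, (3.133) p.422, Thm 3.3 p.399, (3.42) p.397, p.391, Cor. 3.5 p.407; Balaban1984PropagatorsII, Prop. 2.6 (2.136) p.247, Lemma 2.1 (2.61) p.234; Balaban1984PropagatorsI, (1.18) p.20] -/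
theorem hasMaj_D_G0_Qstar_one_Z (hG : GeoOK (geo9K i)) [Fintype (geo9K i).Site] [Fintype W]
    (hc : cR39 b ≠ 0) (hparB : ∀ s s', parB (fun _ _ => 1) s s' = 1)
    (hO : ∀ (J : FBondY i → ℝ) (E : 𝔸), O (fun _ _ => 1) (liftY J E) = liftY (Gop i J) E) {U₁ : B.Cfg} (hU₁ : cfg U₁ = fun _ _ => 1)
    {bI : FBondY i → IBondY i} (hlev : ∀ f : FBondY i, lvl i.hN i.D i.hk (bI f) = (blkV1 i.hN i.D f).1.1)
    (hβ1 : ∀ f : FBondY i, (geomT i.D).dist (β i.hN i.D i.hk (bI f)) (blkV1 i.hN i.D f) ≤ 1)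
    (𝔬 : Ops (geo9K i) B (XBK κ i) (XBK κ i) (XHK κ i) W) (hblkY : 𝔬.blkY = blkBK i bI) (hblkZ : 𝔬.blkZ = blkHK i)
    (hG0 : 𝔬.G0 U₁ = GcoK i b B cfg O U₁) (hQs : 𝔬.Qstar U₁ = QscoKH i b B cfg parB U₁) (hD : 𝔬.D U₁ = DcoK i b B cfg U₁)
    {Wt : (geo9K i).Site → ℝ} (hW0 : ∀ a, 0 ≤ Wt a) (hW : ∀ a : IBondY i, ((((ℓ + 1 : ℕ) : ℝ) ^ (d + 1)) ^ lvl i.hN i.D i.hk a)⁻¹ ≤ Wt a)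
    {C δ c : ℝ} (hC : 0 ≤ C) (hδ : 0 ≤ δ) (hc0 : 0 ≤ c)
    (hT : ∀ ν : Fin (d + 1), HasMajorant (g := geomT i.D) (blkV1 i.hN i.D) (DV ν i.cf ∘ₗ Gop i)
      (fun y y' => C * |i.cf|⁻¹ ^ 1 * ((ℓ : ℝ) + 1) ^ (1 * y.1.1) * Real.exp (-(δ * (geomT i.D).dist y y'))))
    (h261 : Ineq261With c (geomT i.D) δ (1 / 4)) {R₀ : ℝ} {H₀ : Prop} :
    HasMaj (weightNorm (BlockNorm.ofBlocks (toB6 (geo9K i) R₀ H₀) 𝔬.blkZ) Wt hW0) (cNorm R₀ H₀ 𝔬.blkY hG.lenle 1)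
      (𝔬.D U₁ ∘ₗ 𝔬.G0 U₁ ∘ₗ 𝔬.Qstar U₁)
      (fun a a' => C * c * Real.exp (3 / 4 * δ * ((ℓ : ℝ) + 4)) * Real.exp (-(3 / 4 * δ * (geo9K i).dist a a'))) := by
  rw [hblkY, hblkZ, hG0, hQs, hD, DcoK_GcoK_comp_QscoKH_one i b B cfg O parB hc hU₁]
  have hK := hasMajorantHom_coordOpKH_of_liftY b (G := toB6 (geo9K i) R₀ H₀) (blk' := fun a : IBondY i => a) (blk := bI)
    (T := fun ν => (DV ν i.cf ∘ₗ Gop i) ∘ₗ Matrix.toLin' (qsK i)) (fun ν ω E => cdB_O_QsY_one_liftY i O parB hparB hO ν ω E)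
    fun ν => hasMajorantHom_comp_qsK_bI_plateau i hlev hβ1 hC hδ 1 (hT ν) h261 R₀ H₀
  have hK0 : ∀ a a' : (geo9K i).Site, 0 ≤ C * c * Real.exp (3 / 4 * δ * ((ℓ : ℝ) + 4)) * (geo9K i).len a ^ 1 * ((((ℓ + 1 : ℕ) : ℝ) ^ (d + 1)) ^ lvl i.hN i.D i.hk a')⁻¹ *
      Real.exp (-(3 / 4 * δ * (geo9K i).dist a a')) := fun a a' => by
    have := (hG.lenpos a).le; have := (plateau_pos i a').le; positivity
  have h0 := B9Thm37AllNorms.hasMaj_of_hasMajorantHom (G := toB6 (geo9K i) R₀ H₀) (blkHK i) (blkBK i bI) hK0 hK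
  refine B9SectDSup.HasMaj.weight hW0 (wt_nonneg hG.lenle 1) h0 fun y y' => ?_
  have hly : (geo9K i).len y ^ 1 ≠ 0 := pow_ne_zero 1 (hG.lenpos y).ne'
  have hKc : 0 ≤ C * c * Real.exp (3 / 4 * δ * ((ℓ : ℝ) + 4)) * Real.exp (-(3 / 4 * δ * (geo9K i).dist y y')) := by positivity
  calc wt (geo9K i) 1 y * (C * c * Real.exp (3 / 4 * δ * ((ℓ : ℝ) + 4)) * (geo9K i).len y ^ 1 * ((((ℓ + 1 : ℕ) : ℝ) ^ (d + 1)) ^ lvl i.hN i.D i.hk y')⁻¹ *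
        Real.exp (-(3 / 4 * δ * (geo9K i).dist y y')))
      = C * c * Real.exp (3 / 4 * δ * ((ℓ : ℝ) + 4)) * Real.exp (-(3 / 4 * δ * (geo9K i).dist y y')) *
          (((geo9K i).len y ^ 1)⁻¹ * (geo9K i).len y ^ 1) * ((((ℓ + 1 : ℕ) : ℝ) ^ (d + 1)) ^ lvl i.hN i.D i.hk y')⁻¹ := by rw [wt]; ring
    _ = C * c * Real.exp (3 / 4 * δ * ((ℓ : ℝ) + 4)) * Real.exp (-(3 / 4 * δ * (geo9K i).dist y y')) * ((((ℓ + 1 : ℕ) : ℝ) ^ (d + 1)) ^ lvl i.hN i.D i.hk y')⁻¹ := by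
        rw [inv_mul_cancel₀ hly, mul_one]
    _ ≤ _ := mul_le_mul_of_nonneg_left (hW y') hKc

/-- ★★ **`Letters313Z.gQs1` AT `U = 1`** (dag-n06-l's SPLIT letter through the re-classed coarse class): `G₀(1)Q*(1)` from the coarse sup class weighted by
`(Lʲ′η)·W` into `𝔠⁽¹⁾`, i.e. `|(G₀Q*b)(x)| ≦ B₃·Lʲη·L^{j′}η·W(y′)·e^{−δ′d}·sup|b|` — the plateau bound of §1 plus ONE power of `Lʲη` transferred to the source block by
(2.60) (`B9Letters313AtOneQ.len_pow_le_of_transfer`, threshold `log L ≤ ε(2L² − 1)M`).  Constants: `B₃ = C·c·e^{¾δ(ℓ+4)}·L`, `δ′ = ¾δ − ε`.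
[cite: Balaban1985BackgroundPropagators, Thm 3.13 p.426 (letter G₀Q*, split classes), p.398 (remark after (3.47)), (3.126) p.420, p.391, Cor. 3.5 p.407; Balaban1984PropagatorsII, Prop. 2.6 (2.136) p.247, Lemma 2.1 (2.60)–(2.61) p.234; Balaban1984PropagatorsI, (1.18) p.20] -/
theorem hasMaj_G0_Qstar_one_Z_split (hG : GeoOK (geo9K i)) [Fintype (geo9K i).Site] [Fintype Y] [Fintype W]
    (hc : cR39 b ≠ 0) (hparB : ∀ s s', parB (fun _ _ => 1) s s' = 1)
    (hO : ∀ (J : FBondY i → ℝ) (E : 𝔸), O (fun _ _ => 1) (liftY J E) = liftY (Gop i J) E) {U₁ : B.Cfg} (hU₁ : cfg U₁ = fun _ _ => 1)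
    {bI : FBondY i → IBondY i} (hlev : ∀ f : FBondY i, lvl i.hN i.D i.hk (bI f) = (blkV1 i.hN i.D f).1.1)
    (hβ1 : ∀ f : FBondY i, (geomT i.D).dist (β i.hN i.D i.hk (bI f)) (blkV1 i.hN i.D f) ≤ 1)
    (𝔬 : Ops (geo9K i) B (XBK κ i) Y (XHK κ i) W) (hblk : 𝔬.blk = blkBK i bI) (hblkZ : 𝔬.blkZ = blkHK i)
    (hG0 : 𝔬.G0 U₁ = GcoK i b B cfg O U₁) (hQs : 𝔬.Qstar U₁ = QscoKH i b B cfg parB U₁)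
    {Wt : (geo9K i).Site → ℝ} (hW0 : ∀ a, 0 ≤ Wt a) (hW1 : ∀ a, 0 ≤ (geo9K i).len a * Wt a)
    (hW : ∀ a : IBondY i, ((((ℓ + 1 : ℕ) : ℝ) ^ (d + 1)) ^ lvl i.hN i.D i.hk a)⁻¹ ≤ Wt a)
    {C δ c : ℝ} (hC : 0 ≤ C) (hδ : 0 ≤ δ) (hc0 : 0 ≤ c)
    (hT : HasMajorant (g := geomT i.D) (blkV1 i.hN i.D) (Gop i)
      (fun y y' => C * |i.cf|⁻¹ ^ 2 * ((ℓ : ℝ) + 1) ^ (2 * y.1.1) * Real.exp (-(δ * (geomT i.D).dist y y'))))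
    (h261 : Ineq261With c (geomT i.D) δ (1 / 4)) {ε : ℝ} (hε : 0 < ε)
    (hM : Real.log (geo9K i).L ≤ ε * (2 * ((ℓ : ℝ) + 1) ^ 2 - 1) * (geo9K i).M) {R₀ : ℝ} {H₀ : Prop} :
    HasMaj (weightNorm (BlockNorm.ofBlocks (toB6 (geo9K i) R₀ H₀) 𝔬.blkZ) (fun y => (geo9K i).len y * Wt y) hW1)
      (cNorm R₀ H₀ 𝔬.blk hG.lenle 1) (𝔬.G0 U₁ ∘ₗ 𝔬.Qstar U₁)
      (fun a a' => C * c * Real.exp (3 / 4 * δ * ((ℓ : ℝ) + 4)) * (geo9K i).L * Real.exp (-((3 / 4 * δ - ε) * (geo9K i).dist a a'))) := by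
  rw [hblk, hblkZ, hG0, hQs, GcoK_comp_QscoKH_one i b B cfg O parB hc hU₁]
  have hK := hasMajorantHom_coordOpKH_of_liftY b (G := toB6 (geo9K i) R₀ H₀) (blk' := fun a : IBondY i => a) (blk := bI)
    (T := fun _ : Fin (d + 1) => Gop i ∘ₗ Matrix.toLin' (qsK i)) (fun _ ω E => O_QsY_one_liftY i O parB hparB hO ω E)
    fun _ => hasMajorantHom_comp_qsK_bI_plateau i hlev hβ1 hC hδ 2 hT h261 R₀ H₀
  have hK0 : ∀ a a' : (geo9K i).Site, 0 ≤ C * c * Real.exp (3 / 4 * δ * ((ℓ : ℝ) + 4)) * (geo9K i).len a ^ 2 *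
      ((((ℓ + 1 : ℕ) : ℝ) ^ (d + 1)) ^ lvl i.hN i.D i.hk a')⁻¹ * Real.exp (-(3 / 4 * δ * (geo9K i).dist a a')) := fun a a' => by
    have := (hG.lenpos a).le; have := (plateau_pos i a').le; positivity
  have h0 := B9Thm37AllNorms.hasMaj_of_hasMajorantHom (G := toB6 (geo9K i) R₀ H₀) (blkHK i) (blkBK i bI) hK0 hK
  refine B9SectDSup.HasMaj.weight hW1 (wt_nonneg hG.lenle 1) h0 fun y y' => ?_
  -- one power of `Lʲη` to the source block, the plateau against `W`
  have ht : (geo9K i).len y ^ 1 ≤ (geo9K i).L ^ 1 * Real.exp (ε * (geo9K i).dist y' y) * (geo9K i).len y' ^ 1 :=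
    len_pow_le_of_transfer i hε 1 (by rwa [Nat.cast_one, one_mul]) y' y
  rw [pow_one, pow_one, pow_one, geo9K_dist_comm i y' y] at ht
  have hly : (geo9K i).len y ≠ 0 := (hG.lenpos y).ne'
  have hexp : Real.exp (-(3 / 4 * δ * (geo9K i).dist y y')) * Real.exp (ε * (geo9K i).dist y y') =
      Real.exp (-((3 / 4 * δ - ε) * (geo9K i).dist y y')) := by
    rw [← Real.exp_add]; congr 1; ring
  have hKc : 0 ≤ C * c * Real.exp (3 / 4 * δ * ((ℓ : ℝ) + 4)) * Real.exp (-(3 / 4 * δ * (geo9K i).dist y y')) := by positivity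
  have hP : ((((ℓ + 1 : ℕ) : ℝ) ^ (d + 1)) ^ lvl i.hN i.D i.hk y')⁻¹ * (geo9K i).len y ≤
      Wt y' * ((geo9K i).L * Real.exp (ε * (geo9K i).dist y y') * (geo9K i).len y') :=
    mul_le_mul (hW y') ht (hG.lenpos y).le (hW0 y')
  calc wt (geo9K i) 1 y * (C * c * Real.exp (3 / 4 * δ * ((ℓ : ℝ) + 4)) * (geo9K i).len y ^ 2 *
        ((((ℓ + 1 : ℕ) : ℝ) ^ (d + 1)) ^ lvl i.hN i.D i.hk y')⁻¹ * Real.exp (-(3 / 4 * δ * (geo9K i).dist y y')))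
      = C * c * Real.exp (3 / 4 * δ * ((ℓ : ℝ) + 4)) * Real.exp (-(3 / 4 * δ * (geo9K i).dist y y')) *
          (((((ℓ + 1 : ℕ) : ℝ) ^ (d + 1)) ^ lvl i.hN i.D i.hk y')⁻¹ * (geo9K i).len y) *
          ((geo9K i).len y * ((geo9K i).len y ^ 1)⁻¹) := by rw [wt]; ring
    _ = C * c * Real.exp (3 / 4 * δ * ((ℓ : ℝ) + 4)) * Real.exp (-(3 / 4 * δ * (geo9K i).dist y y')) *
          (((((ℓ + 1 : ℕ) : ℝ) ^ (d + 1)) ^ lvl i.hN i.D i.hk y')⁻¹ * (geo9K i).len y) := by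
        rw [pow_one, mul_inv_cancel₀ hly, mul_one]
    _ ≤ C * c * Real.exp (3 / 4 * δ * ((ℓ : ℝ) + 4)) * Real.exp (-(3 / 4 * δ * (geo9K i).dist y y')) *
          (Wt y' * ((geo9K i).L * Real.exp (ε * (geo9K i).dist y y') * (geo9K i).len y')) := mul_le_mul_of_nonneg_left hP hKc
    _ = C * c * Real.exp (3 / 4 * δ * ((ℓ : ℝ) + 4)) * (geo9K i).L *
          (Real.exp (-(3 / 4 * δ * (geo9K i).dist y y')) * Real.exp (ε * (geo9K i).dist y y')) * ((geo9K i).len y' * Wt y') := by ring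
    _ = _ := by rw [hexp]

end Letters

/-! ## §3 UNIFORMLY ON THE CENSUS: one threshold, one constant, one rate for every member, every such record, every weight `W ≥` plateau -/

section Record

variable {𝔸 : Type} [NormedRing 𝔸] [NormedAlgebra ℂ 𝔸] [CompleteSpace 𝔸] [FiniteDimensional ℝ 𝔸]
variable {κ : Type} [Fintype κ]

/-- ★★★ **THE `G₀`-SIDE LETTERS OF THE R1-cls SCHEMAS AT `U = 1`, UNIFORMLY ON THE k-LEVEL CENSUS** — `LettersHZ.gQs2 ∕ dgQs` and `Letters313Z.gQs2 ∕ gQs1`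
(dag-n06-l) out of a block-count-weighted coarse class: for the band `0 < b₀ ≤ b₁` there are `M₁, B₃, δ₃ > 0` such that for every index `i` with `M ≥ M₁`,
every letter record `𝔬` over `geo9K i` with carriers `XBK ∕ XBK ∕ XHK ∕ W` pinned at a configuration `U₁` reading `1` to `GcoK … O ∕ QscoKH … parB ∕ DcoK`
(`O(1)(J ⊗ E) = (GJ) ⊗ E`, transporters trivial at `1`, `cR39 b ≠ 0`), block maps `blkBK bI ∕ blkBK bI ∕ blkHK` (`bI` level- and 1-faithful), and EVERY
non-negative coarse weight `W` with `W(a′) ≥ (L^{d+1})^{−j(a′)}` (node00-def-Y's block count: equality, `plateau_eq_len_div_eta_pow`):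
`G₀(1)Q*(1) : (W-weighted 𝔠_Z) → 𝔠⁽²⁾`, `∇_U G₀(1)Q*(1) : (W-weighted 𝔠_Z) → 𝔠_Y⁽¹⁾` and `G₀(1)Q*(1) : ((Lʲη·W)-weighted 𝔠_Z) → 𝔠⁽¹⁾`, all with the
majorant `B₃·e^{−δ₃d}` (N03's Prop. 2.6 constants, p21's (2.61) row sum, the (2.60) transfer at `4 log L ∕ δ`).
[cite: Balaban1985BackgroundPropagators, (3.126) p.420, (3.132)–(3.133) p.422, Thm 3.3 p.399, Thm 3.13 p.426, p.391, p.398 (remark after (3.47)), Cor. 3.5 p.407; Balaban1984PropagatorsII, Prop. 2.6 (2.136) p.247, Lemma 2.1 (2.60)–(2.61) p.234; Balaban1984PropagatorsI, (1.18) p.20] -/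
theorem lettersHZ_G0_one_kIdx (hb₀ : 0 < b₀) (hb₁ : b₀ ≤ b₁) : ∃ M₁ B₃ δ₃ : ℝ, 0 < M₁ ∧ 0 < B₃ ∧ 0 < δ₃ ∧
    ∀ i : KIdx d ℓ hd hL b₀ b₁, M₁ ≤ (geo9K i).M → ∀ (hG : GeoOK (geo9K i)) [Fintype (geo9K i).Site] {W : Type} [Fintype W]
      (b : Module.Basis κ ℝ 𝔸), cR39 b ≠ 0 → ∀ (B : B9.Backgrounds) (cfg : B.Cfg → CfgY 𝔸 i) (O : BondOpY 𝔸 i) (parB : BondParY 𝔸 i),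
      (∀ s s', parB (fun _ _ => 1) s s' = 1) → (∀ (J : FBondY i → ℝ) (E : 𝔸), O (fun _ _ => 1) (liftY J E) = liftY (Gop i J) E) →
      ∀ {U₁ : B.Cfg}, cfg U₁ = (fun _ _ => 1) → ∀ {bI : FBondY i → IBondY i},
      (∀ f : FBondY i, lvl i.hN i.D i.hk (bI f) = (blkV1 i.hN i.D f).1.1) →
      (∀ f : FBondY i, (geomT i.D).dist (β i.hN i.D i.hk (bI f)) (blkV1 i.hN i.D f) ≤ 1) →
      ∀ (𝔬 : Ops (geo9K i) B (XBK κ i) (XBK κ i) (XHK κ i) W),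
      𝔬.blk = blkBK i bI → 𝔬.blkY = blkBK i bI → 𝔬.blkZ = blkHK i →
      𝔬.G0 U₁ = GcoK i b B cfg O U₁ → 𝔬.Qstar U₁ = QscoKH i b B cfg parB U₁ → 𝔬.D U₁ = DcoK i b B cfg U₁ →
      ∀ {Wt : (geo9K i).Site → ℝ} (hW0 : ∀ a, 0 ≤ Wt a) (hW1 : ∀ a, 0 ≤ (geo9K i).len a * Wt a),
      (∀ a : IBondY i, ((((ℓ + 1 : ℕ) : ℝ) ^ (d + 1)) ^ lvl i.hN i.D i.hk a)⁻¹ ≤ Wt a) →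
      ∀ {R₀ : ℝ} {H₀ : Prop},
        HasMaj (weightNorm (BlockNorm.ofBlocks (toB6 (geo9K i) R₀ H₀) 𝔬.blkZ) Wt hW0) (cNorm R₀ H₀ 𝔬.blk hG.lenle 2)
          (𝔬.G0 U₁ ∘ₗ 𝔬.Qstar U₁) (fun a a' => B₃ * Real.exp (-(δ₃ * (geo9K i).dist a a'))) ∧
        HasMaj (weightNorm (BlockNorm.ofBlocks (toB6 (geo9K i) R₀ H₀) 𝔬.blkZ) Wt hW0) (cNorm R₀ H₀ 𝔬.blkY hG.lenle 1)
          (𝔬.D U₁ ∘ₗ 𝔬.G0 U₁ ∘ₗ 𝔬.Qstar U₁) (fun a a' => B₃ * Real.exp (-(δ₃ * (geo9K i).dist a a'))) ∧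
        HasMaj (weightNorm (BlockNorm.ofBlocks (toB6 (geo9K i) R₀ H₀) 𝔬.blkZ) (fun y => (geo9K i).len y * Wt y) hW1)
          (cNorm R₀ H₀ 𝔬.blk hG.lenle 1) (𝔬.G0 U₁ ∘ₗ 𝔬.Qstar U₁) (fun a a' => B₃ * Real.exp (-(δ₃ * (geo9K i).dist a a'))) := by
  obtain ⟨M₁, δ₃, C, hM₁, hδ₃, hC, H⟩ := hasMajorant_Gop_kIdx (d := d) (ℓ := ℓ) (hd := hd) (hL := hL) hb₀ hb₁
  obtain ⟨N, c, -, hc0, hcon⟩ := consts_260_261 d ℓ hδ₃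
  set Lr : ℝ := (((ℓ + 1 : ℕ) : ℝ)) with hLr
  have hLr1 : 1 ≤ Lr := by rw [hLr]; exact_mod_cast Nat.succ_le_succ (Nat.zero_le ℓ)
  set lg : ℝ := Real.log Lr with hlg
  have hlg0 : 0 ≤ lg := Real.log_nonneg hLr1
  refine ⟨max (max M₁ ((N : ℝ) + 1)) (4 * lg / δ₃), C * (c + 1) * Real.exp (3 / 4 * δ₃ * ((ℓ : ℝ) + 4)) * Lr, δ₃ / 2,
    lt_max_of_lt_left (lt_max_of_lt_left hM₁), by positivity, by positivity, ?_⟩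
  intro i hM hG _ W _ b hc B cfg O parB hparB hO U₁ hU₁ bI hlev hβ1 𝔬 hblk hblkY hblkZ hG0 hQs hD Wt hW0 hW1 hW R₀ H₀
  have hLcast : (((ℓ + 1 : ℕ) : ℝ)) = (ℓ : ℝ) + 1 := by push_cast; ring
  have hMdef : (geo9K i).M = (((ℓ + 1 : ℕ) : ℝ)) * (i.Mh : ℝ) := rfl
  have hLdef : (geo9K i).L = Lr := rfl
  have hM₁ : M₁ ≤ (kGeoG i).M := ((le_max_left _ _).trans (le_max_left _ _)).trans hM
  have hN : (N : ℝ) + 1 ≤ ((ℓ : ℝ) + 1) * i.Mh := by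
    rw [← hLcast, ← hMdef]; exact ((le_max_right _ _).trans (le_max_left _ _)).trans hM
  have hMw : 4 * lg ≤ (geo9K i).M * δ₃ := (div_le_iff₀ hδ₃).mp ((le_max_right _ _).trans hM)
  have hR1 : 1 ≤ i.R := le_trans (by omega) (toKT i).hR
  have hRN : N + 1 ≤ i.R * ((ℓ + 1) * i.Mh) := by
    have h2 : N + 1 ≤ (ℓ + 1) * i.Mh := by exact_mod_cast hN
    calc N + 1 ≤ 1 * ((ℓ + 1) * i.Mh) := by rw [one_mul]; exact h2
      _ ≤ i.R * ((ℓ + 1) * i.Mh) := Nat.mul_le_mul_right _ hR1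
  obtain ⟨-, h261⟩ := hcon i.k i.Mh i.R i.P' (one_le_Mh i) (toKT i).hP hRN
  obtain ⟨h0, h1, -, -⟩ := H i hM₁
  have hε4 : 0 < δ₃ / 4 := by positivity
  have hMg1 : ((1 : ℕ) : ℝ) * lg / (δ₃ / 4) ≤ (geo9K i).M := by rw [div_le_iff₀ hε4]; push_cast; linarith
  have hT1 := transfer_threshold i hε4 1 hMg1
  have hA := hasMaj_G0_Qstar_one_Z (Y := XBK κ i) (W := W) (R₀ := R₀) (H₀ := H₀) i b B cfg O parB hG hc hparB hO hU₁ hlev hβ1 𝔬 hblk hblkZ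
    hG0 hQs hW0 hW hC.le hδ₃.le hc0 h0 (h261 i.D)
  have hB := hasMaj_D_G0_Qstar_one_Z (W := W) (R₀ := R₀) (H₀ := H₀) i b B cfg O parB hG hc hparB hO hU₁ hlev hβ1 𝔬 hblkY hblkZ hG0 hQs hD
    hW0 hW hC.le hδ₃.le hc0 h1 (h261 i.D)
  have hS := hasMaj_G0_Qstar_one_Z_split (Y := XBK κ i) (W := W) (R₀ := R₀) (H₀ := H₀) i b B cfg O parB hG hc hparB hO hU₁ hlev hβ1 𝔬 hblk
    hblkZ hG0 hQs hW0 hW1 hW hC.le hδ₃.le hc0 h0 (h261 i.D) hε4 (by simpa using hT1)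
  -- one constant `C(c+1)e^{¾δ₃(ℓ+4)}·L`, one rate `½δ₃` (below `¾δ₃` and `¾δ₃ − ¼δ₃`)
  have hdist : ∀ a a' : (geo9K i).Site, 0 ≤ (geo9K i).dist a a' := fun a a' => hG.dnn a a'
  have hmono : ∀ a a' : (geo9K i).Site,
      C * c * Real.exp (3 / 4 * δ₃ * ((ℓ : ℝ) + 4)) * Real.exp (-(3 / 4 * δ₃ * (geo9K i).dist a a')) ≤
        C * (c + 1) * Real.exp (3 / 4 * δ₃ * ((ℓ : ℝ) + 4)) * Lr * Real.exp (-(δ₃ / 2 * (geo9K i).dist a a')) := fun a a' => by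
    have h1' : C * c * Real.exp (3 / 4 * δ₃ * ((ℓ : ℝ) + 4)) ≤ C * (c + 1) * Real.exp (3 / 4 * δ₃ * ((ℓ : ℝ) + 4)) * Lr := by
      calc C * c * Real.exp (3 / 4 * δ₃ * ((ℓ : ℝ) + 4)) ≤ C * (c + 1) * Real.exp (3 / 4 * δ₃ * ((ℓ : ℝ) + 4)) := by gcongr; linarith
        _ = C * (c + 1) * Real.exp (3 / 4 * δ₃ * ((ℓ : ℝ) + 4)) * 1 := (mul_one _).symm
        _ ≤ _ := by gcongr
    have h2' : Real.exp (-(3 / 4 * δ₃ * (geo9K i).dist a a')) ≤ Real.exp (-(δ₃ / 2 * (geo9K i).dist a a')) :=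
      Real.exp_le_exp.2 (by nlinarith [hdist a a', hδ₃.le])
    exact mul_le_mul h1' h2' (Real.exp_nonneg _) (by positivity)
  refine ⟨hA.mono hmono, hB.mono hmono, hS.mono fun a a' => ?_⟩
  have hre : Real.exp (-((3 / 4 * δ₃ - δ₃ / 4) * (geo9K i).dist a a')) = Real.exp (-(δ₃ / 2 * (geo9K i).dist a a')) := by
    congr 1; ring
  rw [hre, hLdef]
  gcongr
  linarith

end Record

end Literature.MathematicalPhysics.QuantumFieldTheory.Balaban1983to89.B9LettersHZAtOne

end
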